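import Literature.Analysis.ValidatedNumerics.TaylorModelL2Split
import HarnessLib

/-!
# Two-sided enclosures of `∫ f·g` over a panel from Taylor models (cross terms of a residual Gram matrix)

Trunk T-ANA (Analysis/ValidatedNumerics); namespace `Literature.Analysis.ValidatedNumerics.PolyMP`.
Sequel of `TaylorModelL2.lean` / `TaylorModelL2Split.lean`, which bound `∫ f²`; here the sign-indefinite product of two
Taylor-modelled functions is enclosed two-sidedly.  On `|ρ| ≤ h` let `P ∋ f`, `Q ∋ g` with rational reference polynomials
`p`, `q`; write `δ_p = tabsI S h (P − p)/S`, `‖p‖ = absBoundQ (shift p mid) rad` over `[a, b]`.  Pointwise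
`|f g − p q| ≤ δ_p ‖q‖ + δ_q ‖p‖ + δ_p δ_q`, so for `[u, v] ⊆ [a, b] ⊆ [-h, h]` with `(u − a) + (b − v) ≤ w`

  `|∫_u^v f g − [∫_a^b p q]| ≤ (b − a)(‖p‖ δ_q + ‖q‖ δ_p + δ_p δ_q) + w ‖p‖ ‖q‖ = crossErrQ …`   (`integral_mul_branch_abs_le`),

the exact rational `[∫_a^b p q] = crossCentreQ p q a b`.  The split version (`integral_mul_split_abs_le`) handles a breakpoint
`β ∈ [b⁻, b⁺]` with different models on the two open pieces (slack `w = b⁺ − b⁻`).  Problem-independent; no facts, no axioms.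

* R. E. Moore, *Interval Analysis*, Prentice-Hall (1966), Ch. 3 (integration of interval enclosures). [cite: Moore1966, Theorem 3.1]

## References

* K. Makino, M. Berz, Int. J. Pure Appl. Math. 4 (2003) 379–456, §6. [folklore]
-/

open MeasureTheory intervalIntegral Set
open scoped Interval

namespace Literature.Analysis.ValidatedNumerics

namespace PolyMP

open Literature.Analysis.ValidatedNumerics.NumericsMP
open Literature.Analysis.ValidatedNumerics.ExpPoly (Poly)
open Literature.Analysis.ValidatedNumerics.ExpPoly

/-- `[∫_a^b p q]` exactly. [folklore] -/
def crossCentreQ (p q : Poly) (a b : ℚ) : ℚ :=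
  Poly.evalQ (Poly.ad 0 (Poly.mul p q)) b - Poly.evalQ (Poly.ad 0 (Poly.mul p q)) a

/-- The error radius `(b − a)(‖p‖ δ_q + ‖q‖ δ_p + δ_p δ_q) + w ‖p‖ ‖q‖` (norms over `[a, b]`). [folklore] -/
def crossErrQ (S : ℕ) (h : ℚ) (P : IPoly) (p : Poly) (Q : IPoly) (q : Poly) (a b w : ℚ) : ℚ :=
  let dp : ℚ := (tabsI S h (tsubI P (ratPolyI S p)) : ℚ) / S
  let dq : ℚ := (tabsI S h (tsubI Q (ratPolyI S q)) : ℚ) / S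
  let Ap : ℚ := absBoundQ (Poly.shift p ((a + b) / 2)) ((b - a) / 2)
  let Aq : ℚ := absBoundQ (Poly.shift q ((a + b) / 2)) ((b - a) / 2)
  (b - a) * (Ap * dq + Aq * dp + dp * dq) + w * (Ap * Aq)

/-- `∫_a^b p q = crossCentreQ p q a b`. [cite: Moore1966, Theorem 3.1] -/
theorem integral_eval_mul_eq_crossCentreQ (p q : Poly) (a b : ℚ) :
    ∫ ρ in (a : ℝ)..b, Poly.eval p ρ * Poly.eval q ρ = ((crossCentreQ p q a b : ℚ) : ℝ) := by
  have h1 : ∫ ρ in (a : ℝ)..b, Poly.eval p ρ * Poly.eval q ρ =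
      Poly.eval (Poly.ad 0 (Poly.mul p q)) b - Poly.eval (Poly.ad 0 (Poly.mul p q)) a := by
    rw [← integral_eq_sub_of_hasDerivAt (fun x _ => hasDerivAt_eval_ad_zero (Poly.mul p q) x)
      ((Poly.continuous_eval _).intervalIntegrable _ _)]
    exact intervalIntegral.integral_congr fun ρ _ => by simp only [Poly.eval_mul]
  rw [h1, crossCentreQ, Rat.cast_sub, Poly.eval_evalQ, Poly.eval_evalQ]

/-- **One branch.**  `|∫_u^v f g − [∫_a^b p q]| ≤ crossErrQ S h P p Q q a b w` whenever `f = FX ∈ P`, `g = GX ∈ Q` on the open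
piece `(u, v)`, `[u, v] ⊆ [a, b] ⊆ [-h, h]`, `(u − a) + (b − v) ≤ w`, and `f g` is interval integrable on `[u, v]`. [cite: Moore1966, Theorem 3.1] -/
theorem integral_mul_branch_abs_le {S : ℕ} (hS : 0 < S) {h : ℚ} (h0 : 0 ≤ h) {f g FX GX : ℝ → ℝ} {P Q : IPoly}
    (hF : TMem S h FX P) (hG : TMem S h GX Q) (p q : Poly) {u v : ℝ} {a b w : ℚ} (ha : -(h : ℝ) ≤ a) (hau : (a : ℝ) ≤ u)
    (huv : u ≤ v) (hvb : v ≤ b) (hb : (b : ℝ) ≤ h) (hw : (u - a) + (b - v) ≤ (w : ℝ))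
    (hf : ∀ ρ ∈ Ioo u v, f ρ = FX ρ) (hg : ∀ ρ ∈ Ioo u v, g ρ = GX ρ)
    (hfg : IntervalIntegrable (fun ρ => f ρ * g ρ) volume u v) :
    |(∫ ρ in u..v, f ρ * g ρ) - ((crossCentreQ p q a b : ℚ) : ℝ)| ≤ ((crossErrQ S h P p Q q a b w : ℚ) : ℝ) := by
  set dp : ℝ := (tabsI S h (tsubI P (ratPolyI S p)) : ℝ) / S with hdp
  set dq : ℝ := (tabsI S h (tsubI Q (ratPolyI S q)) : ℝ) / S with hdq
  set Ap : ℝ := (absBoundQ (Poly.shift p ((a + b) / 2)) ((b - a) / 2) : ℝ) with hAp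
  set Aq : ℝ := (absBoundQ (Poly.shift q ((a + b) / 2)) ((b - a) / 2) : ℝ) with hAq
  set K : ℝ := Ap * dq + Aq * dp + dp * dq with hK
  have hhr : (0 : ℝ) ≤ h := by exact_mod_cast h0
  have hdp0 : 0 ≤ dp := (abs_nonneg _).trans (abs_sub_poly_le_of_tmem hS h0 hF p (by rw [abs_zero]; exact hhr))
  have hdq0 : 0 ≤ dq := (abs_nonneg _).trans (abs_sub_poly_le_of_tmem hS h0 hG q (by rw [abs_zero]; exact hhr))
  have hab : (a : ℝ) ≤ b := hau.trans (huv.trans hvb)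
  have hAp0 : 0 ≤ Ap := (abs_nonneg _).trans (abs_eval_le_absBoundQ_loc p le_rfl hab)
  have hAq0 : 0 ≤ Aq := (abs_nonneg _).trans (abs_eval_le_absBoundQ_loc q le_rfl hab)
  -- pointwise bound on the open piece (the endpoint `v` is a null set)
  have hpq_cont : Continuous fun ρ => Poly.eval p ρ * Poly.eval q ρ :=
    (Poly.continuous_eval p).mul (Poly.continuous_eval q)
  have hpqi : ∀ x y : ℝ, IntervalIntegrable (fun ρ => Poly.eval p ρ * Poly.eval q ρ) volume x y := fun x y =>
    hpq_cont.intervalIntegrable _ _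
  have hpt : ∀ ρ ∈ Ioo u v, |f ρ * g ρ - Poly.eval p ρ * Poly.eval q ρ| ≤ K := by
    intro ρ hρo
    have hρh : |ρ| ≤ h := abs_le.2 ⟨by linarith [hρo.1], by linarith [hρo.2]⟩
    rw [hf ρ hρo, hg ρ hρo]
    have e : FX ρ * GX ρ - Poly.eval p ρ * Poly.eval q ρ =
        (FX ρ - Poly.eval p ρ) * GX ρ + Poly.eval p ρ * (GX ρ - Poly.eval q ρ) := by ring
    have h1 : |FX ρ - Poly.eval p ρ| ≤ dp := abs_sub_poly_le_of_tmem hS h0 hF p hρh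
    have h2 : |GX ρ - Poly.eval q ρ| ≤ dq := abs_sub_poly_le_of_tmem hS h0 hG q hρh
    have h3 : |Poly.eval p ρ| ≤ Ap := abs_eval_le_absBoundQ_loc p (by linarith [hρo.1]) (by linarith [hρo.2])
    have h4 : |Poly.eval q ρ| ≤ Aq := abs_eval_le_absBoundQ_loc q (by linarith [hρo.1]) (by linarith [hρo.2])
    have h5 : |GX ρ| ≤ Aq + dq := by
      have : GX ρ = Poly.eval q ρ + (GX ρ - Poly.eval q ρ) := by ring
      rw [this]; exact (abs_add_le _ _).trans (add_le_add h4 h2)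
    rw [e]
    calc |(FX ρ - Poly.eval p ρ) * GX ρ + Poly.eval p ρ * (GX ρ - Poly.eval q ρ)|
        ≤ |(FX ρ - Poly.eval p ρ) * GX ρ| + |Poly.eval p ρ * (GX ρ - Poly.eval q ρ)| := abs_add_le _ _
      _ = |FX ρ - Poly.eval p ρ| * |GX ρ| + |Poly.eval p ρ| * |GX ρ - Poly.eval q ρ| := by rw [abs_mul, abs_mul]
      _ ≤ dp * (Aq + dq) + Ap * dq :=
          add_le_add (mul_le_mul h1 h5 (abs_nonneg _) hdp0) (mul_le_mul h3 h2 (abs_nonneg _) hAp0)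
      _ = K := by rw [hK]; ring
  have hK0 : 0 ≤ K := by rw [hK]; positivity
  -- (1) the model part: |∫_u^v (f g − p q)| ≤ K (v − u) ≤ K (b − a)
  have hne : ∀ᵐ ρ : ℝ ∂volume, ρ ≠ v := by rw [ae_iff]; simp
  have h1 : ‖∫ ρ in u..v, (f ρ * g ρ - Poly.eval p ρ * Poly.eval q ρ)‖ ≤ K * |v - u| := by
    refine intervalIntegral.norm_integral_le_of_norm_le_const_ae ?_
    filter_upwards [hne] with ρ hρne hρ
    rw [uIoc_of_le huv] at hρ
    rw [Real.norm_eq_abs]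
    exact hpt ρ ⟨hρ.1, lt_of_le_of_ne hρ.2 hρne⟩
  have h1' : |(∫ ρ in u..v, f ρ * g ρ) - ∫ ρ in u..v, Poly.eval p ρ * Poly.eval q ρ| ≤ K * (b - a) := by
    rw [← intervalIntegral.integral_sub hfg (hpqi u v), ← Real.norm_eq_abs]
    refine h1.trans ?_
    rw [abs_of_nonneg (by linarith)]
    exact mul_le_mul_of_nonneg_left (by linarith) hK0
  -- (2) the domain part: |∫_u^v p q − ∫_a^b p q| ≤ w ‖p‖ ‖q‖
  have hpq_pt : ∀ ρ, (a : ℝ) ≤ ρ → ρ ≤ b → |Poly.eval p ρ * Poly.eval q ρ| ≤ Ap * Aq := by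
    intro ρ h1 h2
    rw [abs_mul]
    exact mul_le_mul (abs_eval_le_absBoundQ_loc p h1 h2) (abs_eval_le_absBoundQ_loc q h1 h2) (abs_nonneg _) hAp0
  have h2a : ‖∫ ρ in (a : ℝ)..u, Poly.eval p ρ * Poly.eval q ρ‖ ≤ Ap * Aq * |u - a| := by
    refine intervalIntegral.norm_integral_le_of_norm_le_const fun ρ hρ => ?_
    rw [uIoc_of_le hau] at hρ
    rw [Real.norm_eq_abs]; exact hpq_pt ρ hρ.1.le (hρ.2.trans (huv.trans hvb))
  have h2b : ‖∫ ρ in v..(b : ℝ), Poly.eval p ρ * Poly.eval q ρ‖ ≤ Ap * Aq * |(b : ℝ) - v| := by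
    refine intervalIntegral.norm_integral_le_of_norm_le_const fun ρ hρ => ?_
    rw [uIoc_of_le hvb] at hρ
    rw [Real.norm_eq_abs]; exact hpq_pt ρ (hau.trans (huv.trans hρ.1.le)) hρ.2
  have hsplit : ∫ ρ in (a : ℝ)..b, Poly.eval p ρ * Poly.eval q ρ =
      (∫ ρ in (a : ℝ)..u, Poly.eval p ρ * Poly.eval q ρ) + (∫ ρ in u..v, Poly.eval p ρ * Poly.eval q ρ) +
        ∫ ρ in v..(b : ℝ), Poly.eval p ρ * Poly.eval q ρ := by
    rw [intervalIntegral.integral_add_adjacent_intervals (hpqi _ _) (hpqi _ _),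
      intervalIntegral.integral_add_adjacent_intervals (hpqi _ _) (hpqi _ _)]
  have h2 : |(∫ ρ in u..v, Poly.eval p ρ * Poly.eval q ρ) - ((crossCentreQ p q a b : ℚ) : ℝ)| ≤ Ap * Aq * w := by
    rw [← integral_eval_mul_eq_crossCentreQ, hsplit]
    have e : (∫ ρ in u..v, Poly.eval p ρ * Poly.eval q ρ) -
        ((∫ ρ in (a : ℝ)..u, Poly.eval p ρ * Poly.eval q ρ) + (∫ ρ in u..v, Poly.eval p ρ * Poly.eval q ρ) +
          ∫ ρ in v..(b : ℝ), Poly.eval p ρ * Poly.eval q ρ) =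
        -((∫ ρ in (a : ℝ)..u, Poly.eval p ρ * Poly.eval q ρ) + ∫ ρ in v..(b : ℝ), Poly.eval p ρ * Poly.eval q ρ) := by ring
    rw [e, abs_neg]
    refine (abs_add_le _ _).trans ?_
    rw [← Real.norm_eq_abs, ← Real.norm_eq_abs]
    refine (add_le_add h2a h2b).trans ?_
    rw [abs_of_nonneg (by linarith), abs_of_nonneg (by linarith)]
    have hAA : 0 ≤ Ap * Aq := mul_nonneg hAp0 hAq0
    nlinarith
  -- combine
  have e : (∫ ρ in u..v, f ρ * g ρ) - ((crossCentreQ p q a b : ℚ) : ℝ) =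
      ((∫ ρ in u..v, f ρ * g ρ) - ∫ ρ in u..v, Poly.eval p ρ * Poly.eval q ρ) +
        ((∫ ρ in u..v, Poly.eval p ρ * Poly.eval q ρ) - ((crossCentreQ p q a b : ℚ) : ℝ)) := by ring
  rw [e]
  refine (abs_add_le _ _).trans ?_
  refine (add_le_add h1' h2).trans (le_of_eq ?_)
  rw [crossErrQ]
  push_cast
  simp only [← hdp, ← hdq, ← hAp, ← hAq, hK]
  ring

/-- **Whole panel, one model each** (`u = a = −h`, `v = b = h`, no slack). [cite: Moore1966, Theorem 3.1] -/
theorem integral_mul_abs_le {S : ℕ} (hS : 0 < S) {h : ℚ} (h0 : 0 ≤ h) {f g : ℝ → ℝ} {P Q : IPoly}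
    (hF : TMem S h f P) (hG : TMem S h g Q) (p q : Poly)
    (hfg : IntervalIntegrable (fun ρ => f ρ * g ρ) volume (-(h : ℝ)) h) :
    |(∫ ρ in (-(h : ℝ))..h, f ρ * g ρ) - ((crossCentreQ p q (-h) h : ℚ) : ℝ)| ≤
      ((crossErrQ S h P p Q q (-h) h 0 : ℚ) : ℝ) := by
  have hhr : (0 : ℝ) ≤ h := by exact_mod_cast h0
  have := integral_mul_branch_abs_le hS h0 hF hG p q (u := -(h : ℝ)) (v := h) (a := -h) (b := h) (w := 0)
    (by push_cast; exact le_rfl) (by push_cast; exact le_rfl) (by linarith) le_rfl le_rfl (by push_cast; linarith)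
    (fun _ _ => rfl) (fun _ _ => rfl) hfg
  simpa using this

/-- **Panel with an enclosed breakpoint** `β ∈ [b⁻, b⁺] ⊆ [-h, h]`: `f = FA`, `g = GA` on `(-h, β)` and `f = FB`, `g = GB` on
`(β, h)`, each Taylor-modelled on the whole panel.  Then `∫_{-h}^{h} f g` lies within
`crossErrQ … (−h) b⁺ (b⁺−b⁻) + crossErrQ … b⁻ h (b⁺−b⁻)` of `crossCentreQ pA qA (−h) b⁻ + crossCentreQ pB qB b⁺ h`… more
precisely of the two centres over `[-h, b⁺]` and `[b⁻, h]` with slack `b⁺ − b⁻`. [cite: Moore1966, Theorem 3.1] -/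
theorem integral_mul_split_abs_le {S : ℕ} (hS : 0 < S) {h : ℚ} (h0 : 0 ≤ h) {f g FA GA FB GB : ℝ → ℝ}
    {PA QA PB QB : IPoly} (hFA : TMem S h FA PA) (hGA : TMem S h GA QA) (hFB : TMem S h FB PB) (hGB : TMem S h GB QB)
    (pA qA pB qB : Poly) {β : ℝ} {bm bp : ℚ}
    (hbm : -h ≤ bm) (hbmβ : (bm : ℝ) ≤ β) (hβbp : β ≤ bp) (hbp : bp ≤ h)
    (hfA : ∀ ρ ∈ Ioo (-(h : ℝ)) β, f ρ = FA ρ) (hgA : ∀ ρ ∈ Ioo (-(h : ℝ)) β, g ρ = GA ρ)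
    (hfB : ∀ ρ ∈ Ioo β h, f ρ = FB ρ) (hgB : ∀ ρ ∈ Ioo β h, g ρ = GB ρ)
    (hfg : IntervalIntegrable (fun ρ => f ρ * g ρ) volume (-(h : ℝ)) h) :
    |(∫ ρ in (-(h : ℝ))..h, f ρ * g ρ) -
        (((crossCentreQ pA qA (-h) bp : ℚ) : ℝ) + ((crossCentreQ pB qB bm h : ℚ) : ℝ))| ≤
      ((crossErrQ S h PA pA QA qA (-h) bp (bp - bm) : ℚ) : ℝ) +
        ((crossErrQ S h PB pB QB qB bm h (bp - bm) : ℚ) : ℝ) := by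
  have hbm' : (-(h : ℝ)) ≤ bm := by exact_mod_cast hbm
  have hbp' : ((bp : ℚ) : ℝ) ≤ h := by exact_mod_cast hbp
  have hβ1 : -(h : ℝ) ≤ β := hbm'.trans hbmβ
  have hβ2 : β ≤ h := hβbp.trans hbp'
  have hIA : IntervalIntegrable (fun ρ => f ρ * g ρ) volume (-(h : ℝ)) β :=
    hfg.mono_set (by rw [uIcc_of_le hβ1, uIcc_of_le (hβ1.trans hβ2)]; exact Icc_subset_Icc le_rfl hβ2)
  have hIB : IntervalIntegrable (fun ρ => f ρ * g ρ) volume β h :=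
    hfg.mono_set (by rw [uIcc_of_le hβ2, uIcc_of_le (hβ1.trans hβ2)]; exact Icc_subset_Icc hβ1 le_rfl)
  rw [← integral_add_adjacent_intervals hIA hIB]
  have hA := integral_mul_branch_abs_le hS h0 hFA hGA pA qA (u := -(h : ℝ)) (v := β) (a := -h) (b := bp) (w := bp - bm)
    (by push_cast; exact le_rfl) (by push_cast; exact le_rfl) hβ1 hβbp hbp' (by push_cast; linarith) hfA hgA hIA
  have hB := integral_mul_branch_abs_le hS h0 hFB hGB pB qB (u := β) (v := (h : ℝ)) (a := bm) (b := h) (w := bp - bm)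
    hbm' hbmβ hβ2 le_rfl le_rfl (by push_cast; linarith) hfB hgB hIB
  have e : (∫ ρ in (-(h : ℝ))..β, f ρ * g ρ) + (∫ ρ in β..(h : ℝ), f ρ * g ρ) -
      (((crossCentreQ pA qA (-h) bp : ℚ) : ℝ) + ((crossCentreQ pB qB bm h : ℚ) : ℝ)) =
      ((∫ ρ in (-(h : ℝ))..β, f ρ * g ρ) - ((crossCentreQ pA qA (-h) bp : ℚ) : ℝ)) +
        ((∫ ρ in β..(h : ℝ), f ρ * g ρ) - ((crossCentreQ pB qB bm h : ℚ) : ℝ)) := by ring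
  rw [e]
  have hA' : |(∫ ρ in (-(h : ℝ))..β, f ρ * g ρ) - ((crossCentreQ pA qA (-h) bp : ℚ) : ℝ)| ≤
      ((crossErrQ S h PA pA QA qA (-h) bp (bp - bm) : ℚ) : ℝ) := by simpa using hA
  exact (abs_add_le _ _).trans (add_le_add hA' hB)

end PolyMP

end Literature.Analysis.ValidatedNumerics
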